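import Summits.CriticalPhenomena.PercolationContinuityZ3.Theorems.PercNearOneGluingNoHeavyLowerTailCoinPatterns
import Summits.CriticalPhenomena.PercolationContinuityZ3.Theorems.PercNearOneGluingNoHeavyLowerTailSelfGluingDominance
import HarnessLib

/-!
# `NoHeavyLowerTail` (stmt-CriticalPhenomena-4575) — coin reduction of the pattern-lightest bound, part 3b:
# the cross term, the one-coin step, and the reduction to coin-free observers

Support file (prover `prim-hp-8`, PL programme / coin reduction; `--supports stmt-CriticalPhenomena-4575`).
No definitions, no named facts, no sorries.  Notation of `…CoinPatterns.lean`: pattern `π⁰`, ranking `r` (injective on `A`,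
compatible with lightness in `H` = the weights with the pairs at `o` switched off), selection events `Sel_b`, and the
pattern-lightest functional `Φ_r(v) = Σ_{b∈A} μ_v(Sel_b)·μ_v(R_b) − μ_v(1 ≤ N ≤ j)`.

* `coinCross_nonneg` — for a coin `o–c` (`c ∈ A`) absent in `v` (`v s(o,c) = 0`) and `v⁺ = v[oc ↦ 1]`:
  `Σ_b (μ_{v⁺}(Sel_b) − μ_v(Sel_b))·(μ_v(R_b) − μ_{v⁺}(R_b)) ≥ 0`.  Gluing the coin adds `c` to the pattern
  (`CoinReduction.pattern_insert`), so the selection moves to `c` exactly from the empty pattern and from relays ranked above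
  `c`; for those, the lightness loss is at most that of `c` by self-gluing dominance `CoinReduction.selfGluingLoss_ge_general`.
* `coinStep` — THE ONE-COIN STEP: with `u = v s(o,c)`,  `Φ_r(v) ≥ (1 − u)·Φ_r(v[oc ↦ 0])`.
  (One-bond expansion `Φ_r(v) = (1−u)Φ_r(v⁰) + uΦ_r(v¹) + u(1−u)·cross`, `Φ_r(v¹) ≥ 0` by `CoinReduction.gluedCoin_nonneg`,
  `cross ≥ 0` by `coinCross_nonneg`.)
The iteration over all coins and its corollaries (reduction to coin-free observers; the pattern-lightest bound for every
relay-neighboured observer and every `H`-compatible ranking) are in `…CoinReduction.lean`.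

Memo PROOF-COIN-REDUCTION.md on the item (§1, §4, §5).
-/

noncomputable section

namespace Summit.CriticalPhenomena.PercolationContinuityZ3.Theorems

namespace CoinReduction

open MeasureTheory Set Literature.Probability.LatticeModels Literature.Probability.Percolation
open scoped Classical BigOperators

variable {n : ℕ}

/-- The restricted weights (`H`) do not see the pairs at `o`. [folklore] -/
theorem restrict_update_eq (v : Sym2 (Fin n) → unitInterval) (o y : Fin n) (t : unitInterval) :
    (fun e : Sym2 (Fin n) => if e ∈ {e : Sym2 (Fin n) | o ∉ e} then Function.update v s(o, y) t e else 0) =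
      fun e : Sym2 (Fin n) => if e ∈ {e : Sym2 (Fin n) | o ∉ e} then v e else 0 := by
  funext e
  by_cases he : e ∈ {e : Sym2 (Fin n) | o ∉ e}
  · have hef : e ≠ s(o, y) := by
      intro h'; apply he; rw [h']; exact Sym2.mem_mk_left o y
    simp only [he, if_true, Function.update_of_ne hef]
  · simp only [he, if_false]

/-- **The cross term of the one-bond expansion in a coin is nonnegative.**  `o ∉ A`, `c ∈ A`, `v s(o,c) = 0`, `v⁺ = v[oc ↦ 1]`,
`r` injective on `A` and compatible with lightness in `H`.  Then
`0 ≤ Σ_{b∈A} (μ_{v⁺}(Sel_b) − μ_v(Sel_b))·(μ_v(R_b) − μ_{v⁺}(R_b))`. [folklore — via `selfGluingLoss_ge_general` (BHK 1.5)] -/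
theorem coinCross_nonneg (v : Sym2 (Fin n) → unitInterval) (A : Finset (Fin n)) (j : ℕ) {o c : Fin n}
    (r : Fin n → ℕ) (hr : Set.InjOn r ↑A) (hoA : o ∉ A) (hcA : c ∈ A) (hvc : v s(o, c) = 0)
    (hcompat : ∀ b ∈ A, ∀ b' ∈ A, r b < r b' →
      (prodBernoulli fun e : Sym2 (Fin n) => if e ∈ {e : Sym2 (Fin n) | o ∉ e} then v e else 0).real
          {ω : BondConfig (Fin n) | (A.filter fun z => ω ∈ openConn b' z).card ≤ j} ≤
        (prodBernoulli fun e : Sym2 (Fin n) => if e ∈ {e : Sym2 (Fin n) | o ∉ e} then v e else 0).real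
          {ω : BondConfig (Fin n) | (A.filter fun z => ω ∈ openConn b z).card ≤ j}) :
    0 ≤ ∑ b ∈ A,
      ((prodBernoulli (Function.update v s(o, c) 1)).real {ω : BondConfig (Fin n) |
          b ∈ (A.filter fun b' => ω ∈ openConnIn ((↑A : Set (Fin n))ᶜ ∪ {b'}) o b') ∧
          ∀ b' ∈ A, r b' < r b → b' ∉ (A.filter fun b'' => ω ∈ openConnIn ((↑A : Set (Fin n))ᶜ ∪ {b''}) o b'')} -
        (prodBernoulli v).real {ω : BondConfig (Fin n) |
          b ∈ (A.filter fun b' => ω ∈ openConnIn ((↑A : Set (Fin n))ᶜ ∪ {b'}) o b') ∧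
          ∀ b' ∈ A, r b' < r b → b' ∉ (A.filter fun b'' => ω ∈ openConnIn ((↑A : Set (Fin n))ᶜ ∪ {b''}) o b'')}) *
      ((prodBernoulli v).real {ω : BondConfig (Fin n) | (A.filter fun z => ω ∈ openConn b z).card ≤ j} -
        (prodBernoulli (Function.update v s(o, c) 1)).real
          {ω : BondConfig (Fin n) | (A.filter fun z => ω ∈ openConn b z).card ≤ j}) := by
  set μ := prodBernoulli v with hμ
  set μ1 := prodBernoulli (Function.update v s(o, c) 1) with hμ1
  have hco : c ≠ o := fun h => hoA (h ▸ hcA)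
  set pat : BondConfig (Fin n) → Finset (Fin n) :=
    fun ω => A.filter fun b' => ω ∈ openConnIn ((↑A : Set (Fin n))ᶜ ∪ {b'}) o b' with hpat
  set Sel : Fin n → Set (BondConfig (Fin n)) := fun b => {ω | b ∈ pat ω ∧ ∀ b' ∈ A, r b' < r b → b' ∉ pat ω} with hSel
  set R : Fin n → Set (BondConfig (Fin n)) := fun b => {ω | (A.filter fun z => ω ∈ openConn b z).card ≤ j} with hR
  have hmeas : ∀ S : Set (BondConfig (Fin n)), MeasurableSet S := fun S => (Set.toFinite S).measurableSet
  -- the glued measure as a preimage under insertion of the coin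
  have hglue : ∀ S : Set (BondConfig (Fin n)), μ1.real S = μ.real ((fun ω : BondConfig (Fin n) => insert s(o, c) ω) ⁻¹' S) :=
    fun S => ChampionStability.real_update_one_eq v hvc S
  -- losses
  set lam : Fin n → ℝ := fun b => μ.real (R b) - μ1.real (R b) with hlam
  have hlam_c : 0 ≤ lam c := sub_nonneg.2 (PatternLightestStar.loss_self_nonneg v A j hco.symm hvc)
  have hlam_le : ∀ b ∈ A, r c < r b → lam b ≤ lam c := by
    intro b hbA hgt
    have hbo : b ≠ o := fun h => hoA (h ▸ hbA)
    exact selfGluingLoss_ge_general v A j hco hvc hbo (hcompat c hcA b hbA hgt)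
  -- the three cases for the selection probabilities after gluing
  have hlt : ∀ b ∈ A, r b < r c → μ1.real (Sel b) = μ.real (Sel b) := by
    intro b _ hblt
    rw [hglue]
    congr 1
    ext ω
    exact sel_insert_of_lt ω A r hoA hcA hblt
  have hgt : ∀ b ∈ A, r c < r b → μ1.real (Sel b) = 0 := by
    intro b _ hbgt
    rw [hglue]
    have : ((fun ω : BondConfig (Fin n) => insert s(o, c) ω) ⁻¹' Sel b) = ∅ := by
      ext ω
      exact ⟨fun h => absurd h (sel_insert_of_gt ω A r hoA hcA hbgt), fun h => absurd h (Set.notMem_empty ω)⟩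
    rw [this, measureReal_empty]
  -- the gain of c: at least the mass of the relays ranked above c
  set Agt : Finset (Fin n) := A.filter fun b => r c < r b with hAgt
  have hcAgt : c ∉ Agt := by
    intro h; exact lt_irrefl _ (Finset.mem_filter.1 h).2
  have hdisj : (↑(insert c Agt) : Set (Fin n)).PairwiseDisjoint Sel := by
    intro b₁ h₁ b₂ h₂ hne
    have h₁A : b₁ ∈ A := by
      rcases Finset.mem_insert.1 (Finset.mem_coe.1 h₁) with h | h
      · exact h ▸ hcA
      · exact (Finset.mem_filter.1 h).1
    have h₂A : b₂ ∈ A := by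
      rcases Finset.mem_insert.1 (Finset.mem_coe.1 h₂) with h | h
      · exact h ▸ hcA
      · exact (Finset.mem_filter.1 h).1
    exact sel_disjoint A r hr o h₁A h₂A hne
  have hgain : μ.real (Sel c) + ∑ b ∈ Agt, μ.real (Sel b) ≤ μ1.real (Sel c) := by
    rw [hglue]
    have hsub : (⋃ b ∈ insert c Agt, Sel b) ⊆ (fun ω : BondConfig (Fin n) => insert s(o, c) ω) ⁻¹' Sel c := by
      intro ω hω
      rw [mem_iUnion₂] at hω
      obtain ⟨b, hb, hωb⟩ := hω
      rw [mem_preimage]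
      apply (sel_self_insert_iff ω A r hoA hcA).2
      intro b' hb'A hb'lt
      have hle : r c ≤ r b := by
        rcases Finset.mem_insert.1 hb with h | h
        · rw [h]
        · exact le_of_lt (Finset.mem_filter.1 h).2
      exact hωb.2 b' hb'A (lt_of_lt_of_le hb'lt hle)
    calc μ.real (Sel c) + ∑ b ∈ Agt, μ.real (Sel b) = ∑ b ∈ insert c Agt, μ.real (Sel b) :=
          (Finset.sum_insert (f := fun b => μ.real (Sel b)) hcAgt).symm
      _ = μ.real (⋃ b ∈ insert c Agt, Sel b) :=
          (measureReal_biUnion_finset hdisj (fun b _ => hmeas _)).symm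
      _ ≤ μ.real ((fun ω : BondConfig (Fin n) => insert s(o, c) ω) ⁻¹' Sel c) :=
          measureReal_mono hsub (measure_ne_top _ _)
  -- the sum, split at c
  have hsplit : ∑ b ∈ A, (μ1.real (Sel b) - μ.real (Sel b)) * lam b =
      (μ1.real (Sel c) - μ.real (Sel c)) * lam c + ∑ b ∈ A.erase c, (μ1.real (Sel b) - μ.real (Sel b)) * lam b :=
    (Finset.add_sum_erase A _ hcA).symm
  have hrest : ∑ b ∈ A.erase c, (μ1.real (Sel b) - μ.real (Sel b)) * lam b = - ∑ b ∈ Agt, μ.real (Sel b) * lam b := by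
    have h1 : ∑ b ∈ A.erase c, (μ1.real (Sel b) - μ.real (Sel b)) * lam b =
        ∑ b ∈ A.erase c, (if r c < r b then - (μ.real (Sel b) * lam b) else 0) := by
      apply Finset.sum_congr rfl
      intro b hb
      have hbc : b ≠ c := Finset.ne_of_mem_erase hb
      have hbA : b ∈ A := Finset.mem_of_mem_erase hb
      have hne : r b ≠ r c := fun h => hbc (hr (Finset.mem_coe.2 hbA) (Finset.mem_coe.2 hcA) h)
      by_cases hbgt : r c < r b
      · rw [if_pos hbgt, hgt b hbA hbgt]; ring
      · rw [if_neg hbgt]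
        have hblt : r b < r c := by
          rcases lt_or_gt_of_ne hne with h | h
          · exact h
          · exact absurd h hbgt
        rw [hlt b hbA hblt]; ring
    rw [h1, Finset.sum_ite, Finset.sum_const_zero, add_zero, Finset.sum_neg_distrib]
    congr 1
    apply Finset.sum_congr _ (fun _ _ => rfl)
    ext b
    simp only [Finset.mem_filter, Finset.mem_erase, hAgt]
    constructor
    · rintro ⟨⟨_, hbA⟩, h⟩; exact ⟨hbA, h⟩
    · rintro ⟨hbA, h⟩; exact ⟨⟨fun hbc => lt_irrefl _ (hbc ▸ h), hbA⟩, h⟩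
  -- assemble
  have hmain : ∑ b ∈ Agt, μ.real (Sel b) * (lam c - lam b) ≤
      ∑ b ∈ A, (μ1.real (Sel b) - μ.real (Sel b)) * lam b := by
    rw [hsplit, hrest]
    have h1 : (∑ b ∈ Agt, μ.real (Sel b)) * lam c ≤ (μ1.real (Sel c) - μ.real (Sel c)) * lam c :=
      mul_le_mul_of_nonneg_right (by linarith [hgain]) hlam_c
    have h2 : ∑ b ∈ Agt, μ.real (Sel b) * (lam c - lam b) =
        (∑ b ∈ Agt, μ.real (Sel b)) * lam c + - ∑ b ∈ Agt, μ.real (Sel b) * lam b := by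
      rw [Finset.sum_mul, ← sub_eq_add_neg, ← Finset.sum_sub_distrib]
      apply Finset.sum_congr rfl; intro b _; ring
    rw [h2]
    linarith
  have hpos : 0 ≤ ∑ b ∈ Agt, μ.real (Sel b) * (lam c - lam b) := by
    apply Finset.sum_nonneg
    intro b hb
    exact mul_nonneg measureReal_nonneg (sub_nonneg.2 (hlam_le b (Finset.mem_filter.1 hb).1 (Finset.mem_filter.1 hb).2))
  exact hpos.trans hmain

/-- **The one-coin step of the coin reduction.**  `o ∉ A`, `c ∈ A`, `u = v s(o,c)`, `r` injective on `A` and compatible with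
lightness in `H`.  Then  `Φ_r(v) ≥ (1 − u) · Φ_r(v[oc ↦ 0])`, where
`Φ_r(w) = Σ_{b∈A} μ_w(Sel_b)·μ_w(R_b) − μ_w(1 ≤ N ≤ j)`. [folklore — one-bond expansion + `gluedCoin_nonneg` + `coinCross_nonneg`] -/
theorem coinStep (v : Sym2 (Fin n) → unitInterval) (A : Finset (Fin n)) (j : ℕ) {o c : Fin n}
    (r : Fin n → ℕ) (hr : Set.InjOn r ↑A) (hoA : o ∉ A) (hcA : c ∈ A)
    (hcompat : ∀ b ∈ A, ∀ b' ∈ A, r b < r b' →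
      (prodBernoulli fun e : Sym2 (Fin n) => if e ∈ {e : Sym2 (Fin n) | o ∉ e} then v e else 0).real
          {ω : BondConfig (Fin n) | (A.filter fun z => ω ∈ openConn b' z).card ≤ j} ≤
        (prodBernoulli fun e : Sym2 (Fin n) => if e ∈ {e : Sym2 (Fin n) | o ∉ e} then v e else 0).real
          {ω : BondConfig (Fin n) | (A.filter fun z => ω ∈ openConn b z).card ≤ j}) :
    (1 - (v s(o, c) : ℝ)) *
        (∑ b ∈ A, (prodBernoulli (Function.update v s(o, c) 0)).real {ω : BondConfig (Fin n) |
            b ∈ (A.filter fun b' => ω ∈ openConnIn ((↑A : Set (Fin n))ᶜ ∪ {b'}) o b') ∧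
            ∀ b' ∈ A, r b' < r b → b' ∉ (A.filter fun b'' => ω ∈ openConnIn ((↑A : Set (Fin n))ᶜ ∪ {b''}) o b'')} *
          (prodBernoulli (Function.update v s(o, c) 0)).real
            {ω : BondConfig (Fin n) | (A.filter fun z => ω ∈ openConn b z).card ≤ j} -
        (prodBernoulli (Function.update v s(o, c) 0)).real {ω : BondConfig (Fin n) |
          1 ≤ (A.filter fun z => ω ∈ openConn o z).card ∧ (A.filter fun z => ω ∈ openConn o z).card ≤ j}) ≤
      ∑ b ∈ A, (prodBernoulli v).real {ω : BondConfig (Fin n) |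
          b ∈ (A.filter fun b' => ω ∈ openConnIn ((↑A : Set (Fin n))ᶜ ∪ {b'}) o b') ∧
          ∀ b' ∈ A, r b' < r b → b' ∉ (A.filter fun b'' => ω ∈ openConnIn ((↑A : Set (Fin n))ᶜ ∪ {b''}) o b'')} *
        (prodBernoulli v).real {ω : BondConfig (Fin n) | (A.filter fun z => ω ∈ openConn b z).card ≤ j} -
      (prodBernoulli v).real {ω : BondConfig (Fin n) |
        1 ≤ (A.filter fun z => ω ∈ openConn o z).card ∧ (A.filter fun z => ω ∈ openConn o z).card ≤ j} := by
  set e : Sym2 (Fin n) := s(o, c) with he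
  set v0 := Function.update v e 0 with hv0
  set v1 := Function.update v e 1 with hv1
  set μ := prodBernoulli v with hμ
  set μ0 := prodBernoulli v0 with hμ0
  set μ1 := prodBernoulli v1 with hμ1
  set u : ℝ := (v e : ℝ) with hu
  have hu0 : 0 ≤ u := (v e).2.1
  have hu1 : u ≤ 1 := (v e).2.2
  set pat : BondConfig (Fin n) → Finset (Fin n) :=
    fun ω => A.filter fun b' => ω ∈ openConnIn ((↑A : Set (Fin n))ᶜ ∪ {b'}) o b' with hpat
  set Sel : Fin n → Set (BondConfig (Fin n)) := fun b => {ω | b ∈ pat ω ∧ ∀ b' ∈ A, r b' < r b → b' ∉ pat ω} with hSel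
  set R : Fin n → Set (BondConfig (Fin n)) := fun b => {ω | (A.filter fun z => ω ∈ openConn b z).card ≤ j} with hR
  set L : Set (BondConfig (Fin n)) := {ω | 1 ≤ (A.filter fun z => ω ∈ openConn o z).card ∧
    (A.filter fun z => ω ∈ openConn o z).card ≤ j} with hL
  -- restricted weights of v0 and v1 coincide with those of v
  have hres0 := restrict_update_eq v o c 0
  have hres1 := restrict_update_eq v o c 1
  have hv00 : v0 e = 0 := by rw [hv0, Function.update_self]
  have hv11 : v1 e = 1 := by rw [hv1, Function.update_self]
  have hv01 : Function.update v0 e 1 = v1 := by rw [hv0, hv1, Function.update_idem]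
  -- the glued branch is nonnegative
  have hglued : μ1.real L ≤ ∑ b ∈ A, μ1.real (Sel b) * μ1.real (R b) := by
    have h := gluedCoin_nonneg v1 A j r hr hoA hcA hv11 (by rw [hres1]; exact hcompat)
    exact h
  -- the cross term is nonnegative
  have hcross : 0 ≤ ∑ b ∈ A, (μ1.real (Sel b) - μ0.real (Sel b)) * (μ0.real (R b) - μ1.real (R b)) := by
    have h := coinCross_nonneg v0 A j r hr hoA hcA hv00 (by rw [hres0]; exact hcompat)
    rw [hv01] at h
    exact h
  -- one-bond expansions
  have hexpS : ∀ b, μ.real (Sel b) = (1 - u) * μ0.real (Sel b) + u * μ1.real (Sel b) :=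
    fun b => TieLocus.real_oneBond v e (Sel b)
  have hexpR : ∀ b, μ.real (R b) = (1 - u) * μ0.real (R b) + u * μ1.real (R b) :=
    fun b => TieLocus.real_oneBond v e (R b)
  have hexpL : μ.real L = (1 - u) * μ0.real L + u * μ1.real L := TieLocus.real_oneBond v e L
  have hsum : ∑ b ∈ A, μ.real (Sel b) * μ.real (R b) =
      (1 - u) * ∑ b ∈ A, μ0.real (Sel b) * μ0.real (R b) + u * ∑ b ∈ A, μ1.real (Sel b) * μ1.real (R b) +
        u * (1 - u) * ∑ b ∈ A, (μ1.real (Sel b) - μ0.real (Sel b)) * (μ0.real (R b) - μ1.real (R b)) := by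
    rw [Finset.mul_sum, Finset.mul_sum, Finset.mul_sum, ← Finset.sum_add_distrib, ← Finset.sum_add_distrib]
    apply Finset.sum_congr rfl
    intro b _
    rw [hexpS b, hexpR b]
    ring
  change (1 - u) * (∑ b ∈ A, μ0.real (Sel b) * μ0.real (R b) - μ0.real L) ≤
    ∑ b ∈ A, μ.real (Sel b) * μ.real (R b) - μ.real L
  rw [hsum, hexpL]
  have h1 : 0 ≤ u * (∑ b ∈ A, μ1.real (Sel b) * μ1.real (R b) - μ1.real L) :=
    mul_nonneg hu0 (sub_nonneg.2 hglued)
  have h2 : 0 ≤ u * (1 - u) * ∑ b ∈ A, (μ1.real (Sel b) - μ0.real (Sel b)) * (μ0.real (R b) - μ1.real (R b)) :=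
    mul_nonneg (mul_nonneg hu0 (sub_nonneg.2 hu1)) hcross
  linarith

end CoinReduction

end Summit.CriticalPhenomena.PercolationContinuityZ3.Theorems

end
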